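import Mathlib.FieldTheory.IsAlgClosed.AlgebraicClosure
import Literature.Computability.AlgebraicComplexity.DM16FullNcRankProofs

/-!
# Non-commutative rank does not grow under extension of scalars; [DM16, Cor 4.7] and the
# [EGOW18, §6] statement over EVERY field (discharge of `EGOW2018_sec6_derksenMakam`)

Sources: [DM16] H. Derksen, V. Makam, *On non-commutative rank and tensor rank*, LMA 66 (2018) =
arXiv:1606.06701, Cor 4.7 (p. 9), Thm 1.15 (p. 4); [EGOW18] Efremenko–Garg–Oliveira–Wigderson,
ITCS 2018 = arXiv:1710.09502, §6 p. 17 (bullet 4 and Conj 6.1); [BJP18] Bläser–Jindal–Pandey,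
ToC 14 (2018), Def 2.3–2.5 p. 5 (shrunk-subspace form of `ncrk`). Vocabulary:
`Literature/Computability/AlgebraicComplexity/NonCommutativeRank.lean` (`ncRank`, `imageSubspace`,
`shrunkCost`, cover form `ncRank_le_of_cover` / `exists_cover_eq_ncRank`),
`…/DM16NonCommutativeRank.lean` (`extMulMatrix`, `dmSpace`, `dmSquareFamily`, the named statement
`EGOW2018_sec6_derksenMakam`), `…/DM16FullNcRankProofs.lean` (`ncRank_range_extMulMatrix_eq_choose`:
`ncrk 𝒳(p,2p+1) = C(2p+1,p)` over every field with an element `∉ {0,1}`).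

What is added here (all PROVED, no named fact used, no new definition):
1. `ncRank_image_map_le` — for a field homomorphism `φ : K → L` and a set `𝓑` of `K`-matrices,
   `ncrk_L(φ(𝓑)) ≤ ncrk_K(𝓑)`: an optimal zero block of `𝓑` stays a zero block of `φ(𝓑)` of the same
   shape. The proof is matrix-only (no transfer of linear independence): write the optimal cover
   `B(W) ≤ U` with `W = ker A`, `U = ker C` for SURJECTIVE `A`, `C`; then `C B = D_B A` for some
   `D_B`, `C S = 1` for a section `S`; apply `φ` entrywise (`Matrix.map_mul`) and take
   `W' = ker φ(A)`, `U' = ker φ(C)` over `L` (codim `W' ≤` codim `W`, and `dim U' = dim U` because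
   `φ(C) φ(S) = 1`).
2. `ncRank_range_extMulMatrix_full` / `ncRank_dmSpace_full` — **`ncrk 𝒳(p, 2p+1) = C(2p+1, p)` over
   EVERY field**, including `𝔽₂` (the one field `ncRank_range_extMulMatrix_eq_choose` missed): the
   matrices `L_{e_i}` have entries in `{0, ±1}`, so `𝒳` over the algebraic closure `K̄` (infinite, hence
   with an element `∉ {0,1}`) is the entrywise image of `𝒳` over `K`, and
   `C(2p+1,p) = ncrk_{K̄} ≤ ncrk_K ≤ #columns = C(2p+1,p)`.
3. `EGOW2018_sec6_derksenMakam_holds` — **DISCHARGE** of the named [EGOW18, §6 bullet 4] statement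
   (`def EGOW2018_sec6_derksenMakam (F) [Field F] : Prop`, no characteristic hypothesis in the binder)
   for every field; `EGOW2018_conj61_degOne_allFields` — [EGOW18, Conj 6.1] at `d = 1` over every
   field (the tree had it for fields `≠ 𝔽₂`).
Beyond print: [DM16, §4] assumes characteristic `0` and [EGOW18] works over large fields; the
statements below have no field hypothesis. Honest framing: statements about ranks of linear
matrices; nothing here bears on `VP ≠ VNP`.
-/

open MvPolynomial

namespace Literature.Computability.AlgebraicComplexity

/-! ## 1. Non-commutative rank under a homomorphism of fields -/

section BaseChange

variable {K L : Type*} [Field K] [Field L] {ι κ : Type*} [Fintype ι] [Fintype κ]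

omit [Fintype ι] in
/-- The matrix of `v ↦ B v` in the standard bases is `B`.
[cite: BlaeserJindalPandey2018, Def 2.3, p. 5] locator: paper:doi-10-4086-toc-2018-v014a003 p0005.txt:L13 -/
theorem toMatrix'_mulVecLin [DecidableEq κ] (B : Matrix ι κ K) :
    LinearMap.toMatrix' B.mulVecLin = B :=
  LinearMap.toMatrix'_toLin' B

/-- **Non-commutative rank does not grow under extension of scalars**: for a homomorphism of
fields `φ : K → L` and a set `𝓑` of `ι × κ` matrices over `K`, the entrywise images `φ(B)`,
`B ∈ 𝓑`, have `ncrk_L(φ(𝓑)) ≤ ncrk_K(𝓑)` — an optimal zero block (cover `B(W) ≤ U` with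
`codim W + dim U = ncrk 𝓑`, [BJP18, Def 2.5] / [FR04, Thm 1]) survives extension of scalars with
the same codimension and dimension. [cite: BlaeserJindalPandey2018, Def 2.5, p. 5] locator: paper:doi-10-4086-toc-2018-v014a003 p0005.txt:L19 -/
theorem ncRank_image_map_le (φ : K →+* L) (𝓑 : Set (Matrix ι κ K)) :
    ncRank ((fun B : Matrix ι κ K => B.map φ) '' 𝓑) ≤ ncRank 𝓑 := by
  classical
  obtain ⟨U, W, hcov, hsum⟩ := exists_cover_eq_ncRank 𝓑
  -- Present `W` and `U` as kernels of SURJECTIVE linear maps onto coordinate spaces.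
  set c := Module.finrank K ((κ → K) ⧸ W) with hc
  set c' := Module.finrank K ((ι → K) ⧸ U) with hc'
  let eW : ((κ → K) ⧸ W) ≃ₗ[K] (Fin c → K) := LinearEquiv.ofFinrankEq _ _ (by simp [hc])
  let eU : ((ι → K) ⧸ U) ≃ₗ[K] (Fin c' → K) := LinearEquiv.ofFinrankEq _ _ (by simp [hc'])
  let A : (κ → K) →ₗ[K] (Fin c → K) := eW.toLinearMap ∘ₗ W.mkQ
  let C : (ι → K) →ₗ[K] (Fin c' → K) := eU.toLinearMap ∘ₗ U.mkQ
  have hkerC : LinearMap.ker C = U := by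
    rw [LinearEquiv.ker_comp, Submodule.ker_mkQ]
  have hCsurj : Function.Surjective C := eU.surjective.comp (Submodule.mkQ_surjective U)
  obtain ⟨S, hS⟩ :=
    LinearMap.exists_rightInverse_of_surjective C (LinearMap.range_eq_top.2 hCsurj)
  -- The cover condition `B(W) ≤ U` as a factorisation `C ∘ B = D ∘ A`.
  have hfac : ∀ B ∈ 𝓑, ∃ D : (Fin c → K) →ₗ[K] (Fin c' → K), C ∘ₗ B.mulVecLin = D ∘ₗ A := by
    intro B hB
    have hle : W ≤ LinearMap.ker (C ∘ₗ B.mulVecLin) := by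
      intro w hw
      have hBw : B.mulVecLin w ∈ U := hcov B hB ⟨w, hw, rfl⟩
      rw [← hkerC] at hBw
      rw [LinearMap.mem_ker, LinearMap.comp_apply]
      exact LinearMap.mem_ker.1 hBw
    refine ⟨(W.liftQ (C ∘ₗ B.mulVecLin) hle) ∘ₗ eW.symm.toLinearMap, ?_⟩
    refine LinearMap.ext fun v => ?_
    simp only [A, LinearMap.comp_apply, LinearEquiv.coe_coe, LinearEquiv.symm_apply_apply,
      Submodule.mkQ_apply, Submodule.liftQ_apply]
  -- Matrices of `A`, `C` and the section `S`.
  set MA : Matrix (Fin c) κ K := LinearMap.toMatrix' A with hMA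
  set MC : Matrix (Fin c') ι K := LinearMap.toMatrix' C with hMC
  have hCS : MC * LinearMap.toMatrix' S = 1 := by
    rw [hMC, ← LinearMap.toMatrix'_comp, hS, LinearMap.toMatrix'_id]
  -- Over `L`: the kernels of `φ(A)` and `φ(C)`.
  let W' : Submodule L (κ → L) := LinearMap.ker (MA.map φ).mulVecLin
  let U' : Submodule L (ι → L) := LinearMap.ker (MC.map φ).mulVecLin
  have hcov' : ∀ B' ∈ (fun B : Matrix ι κ K => B.map φ) '' 𝓑, W'.map B'.mulVecLin ≤ U' := by
    rintro _ ⟨B, hB, rfl⟩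
    obtain ⟨D, hD⟩ := hfac B hB
    have hmat : MC * B = LinearMap.toMatrix' D * MA := by
      have h := congrArg LinearMap.toMatrix' hD
      rwa [LinearMap.toMatrix'_comp, LinearMap.toMatrix'_comp, toMatrix'_mulVecLin] at h
    rintro _ ⟨v, hv, rfl⟩
    have hv' : (MA.map φ).mulVec v = 0 := by
      simpa only [W', SetLike.mem_coe, LinearMap.mem_ker, Matrix.mulVecLin_apply] using hv
    show (B.map φ).mulVecLin v ∈ LinearMap.ker (MC.map φ).mulVecLin
    rw [LinearMap.mem_ker, Matrix.mulVecLin_apply, Matrix.mulVecLin_apply, Matrix.mulVec_mulVec,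
      ← Matrix.map_mul, hmat, Matrix.map_mul, ← Matrix.mulVec_mulVec, hv', Matrix.mulVec_zero]
  have h1 : Module.finrank L ((κ → L) ⧸ W') ≤ c := by
    rw [(LinearMap.quotKerEquivRange (MA.map φ).mulVecLin).finrank_eq]
    refine (Submodule.finrank_le _).trans ?_
    rw [Module.finrank_fintype_fun_eq_card, Fintype.card_fin]
  have h2 : Module.finrank L U' ≤ Module.finrank K U := by
    have hsurj : Function.Surjective (MC.map φ).mulVecLin := by
      intro y
      refine ⟨((LinearMap.toMatrix' S).map φ).mulVec y, ?_⟩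
      rw [Matrix.mulVecLin_apply, Matrix.mulVec_mulVec, ← Matrix.map_mul, hCS,
        Matrix.map_one φ (map_zero φ) (map_one φ), Matrix.one_mulVec]
    have hrn := LinearMap.finrank_range_add_finrank_ker (MC.map φ).mulVecLin
    rw [LinearMap.range_eq_top.2 hsurj, finrank_top, Module.finrank_fintype_fun_eq_card,
      Module.finrank_fintype_fun_eq_card, Fintype.card_fin] at hrn
    have hK := Submodule.finrank_quotient_add_finrank U
    rw [Module.finrank_fintype_fun_eq_card] at hK
    change c' + Module.finrank L U' = Fintype.card ι at hrn
    omega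
  calc ncRank ((fun B : Matrix ι κ K => B.map φ) '' 𝓑)
      ≤ Module.finrank L ((κ → L) ⧸ W') + Module.finrank L U' := ncRank_le_of_cover _ U' W' hcov'
    _ ≤ c + Module.finrank K U := Nat.add_le_add h1 h2
    _ = ncRank 𝓑 := hsum

/-- Family form of `ncRank_image_map_le`: `ncrk_L {φ(B_a)} ≤ ncrk_K {B_a}`.
[cite: BlaeserJindalPandey2018, Def 2.5, p. 5] locator: paper:doi-10-4086-toc-2018-v014a003 p0005.txt:L19 -/
theorem ncRank_range_map_le {α : Type*} (φ : K →+* L) (B : α → Matrix ι κ K) :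
    ncRank (Set.range fun a => (B a).map φ) ≤ ncRank (Set.range B) := by
  have h : (Set.range fun a => (B a).map φ) = (fun M : Matrix ι κ K => M.map φ) '' Set.range B := by
    rw [← Set.range_comp]
    rfl
  rw [h]
  exact ncRank_image_map_le φ _

end BaseChange

/-! ## 2. `ncrk 𝒳(p, 2p+1) = C(2p+1, p)` over every field -/

section Full

variable {K L : Type*} [Field K] [Field L]

/-- The matrices `L_{e_i}` are defined over `ℤ` (entries `0, ±1`): a field homomorphism maps
`L_{e_i}` over `K` entrywise to `L_{e_i}` over `L`.
[cite: DerksenMakam2018, §4, p. 9] locator: paper:arxiv-1606.06701 p0009.txt:L5 -/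
theorem extMulMatrix_map (φ : K →+* L) (n p : ℕ) (i : Fin n) :
    (extMulMatrix K n p i).map φ = extMulMatrix L n p i := by
  ext T S
  simp [extMulMatrix, wedgeSign, apply_ite φ]

/-- `ncrk{L_{e_i}}` does not grow under a homomorphism of fields `K → L`.
[cite: DerksenMakam2018, Cor 4.7, p. 9] locator: paper:arxiv-1606.06701 p0009.txt:L75 -/
theorem ncRank_range_extMulMatrix_le_of_ringHom (φ : K →+* L) (n p : ℕ) :
    ncRank (Set.range (extMulMatrix L n p)) ≤ ncRank (Set.range (extMulMatrix K n p)) := by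
  have h : Set.range (extMulMatrix L n p) = Set.range fun i => (extMulMatrix K n p i).map φ :=
    congrArg Set.range (funext fun i => (extMulMatrix_map φ n p i).symm)
  rw [h]
  exact ncRank_range_map_le φ _

/-- `ncrk 𝒳(p,n)` does not grow under a homomorphism of fields `K → L`.
[cite: DerksenMakam2018, Cor 4.7, p. 9] locator: paper:arxiv-1606.06701 p0009.txt:L75 -/
theorem ncRank_dmSpace_le_of_ringHom (φ : K →+* L) (n p : ℕ) :
    ncRank (dmSpace L n p : Set (Matrix (ExtIdx n (p + 1)) (ExtIdx n p) L)) ≤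
      ncRank (dmSpace K n p : Set (Matrix (ExtIdx n (p + 1)) (ExtIdx n p) K)) := by
  rw [ncRank_dmSpace, ncRank_dmSpace]
  exact ncRank_range_extMulMatrix_le_of_ringHom φ n p

/-- **`ncrk{L_{e_1}, …, L_{e_{2p+1}}} = C(2p+1, p)` over EVERY field** (also `𝔽₂`): pass to the
algebraic closure (infinite, so it has an element `∉ {0,1}` and `ncRank_range_extMulMatrix_eq_choose`
applies there) and use that `ncrk` does not grow under extension of scalars.
[cite: DerksenMakam2018, Cor 4.7, p. 9] locator: paper:arxiv-1606.06701 p0009.txt:L75 -/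
theorem ncRank_range_extMulMatrix_full (p : ℕ) :
    ncRank (Set.range (extMulMatrix K (2 * p + 1) p)) = (2 * p + 1).choose p := by
  classical
  refine le_antisymm ((ncRank_le_card_cols _).trans (card_extIdx _ _).le) ?_
  obtain ⟨a, ha⟩ := Infinite.exists_notMem_finset ({0, 1} : Finset (AlgebraicClosure K))
  have ha' : ∃ a : AlgebraicClosure K, a ≠ 0 ∧ a ≠ 1 := ⟨a, by simpa using ha⟩
  rw [← ncRank_range_extMulMatrix_eq_choose p ha']
  exact ncRank_range_extMulMatrix_le_of_ringHom (algebraMap K (AlgebraicClosure K)) _ _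

/-- **[DM16, Corollary 4.7] over EVERY field: `ncrk 𝒳(p, 2p+1) = C(2p+1, p)`** (the tree's
`ncRank_dmSpace_eq_choose` needs an element `∉ {0,1}`, `DerksenMakam2018_cor_4_7` characteristic `0`;
no hypothesis here). [cite: DerksenMakam2018, Cor 4.7, p. 9] locator: paper:arxiv-1606.06701 p0009.txt:L75 -/
theorem ncRank_dmSpace_full (p : ℕ) :
    ncRank (dmSpace K (2 * p + 1) p : Set (Matrix (ExtIdx (2 * p + 1) (p + 1))
      (ExtIdx (2 * p + 1) p) K)) = (2 * p + 1).choose p := by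
  rw [ncRank_dmSpace]
  exact ncRank_range_extMulMatrix_full p

/-- **[DM16, Corollary 4.7], every field** — alias in the source's numbering.
[cite: DerksenMakam2018, Cor 4.7, p. 9] locator: paper:arxiv-1606.06701 p0009.txt:L75 -/
theorem DerksenMakam2018_cor_4_7_allFields (K : Type*) [Field K] (p : ℕ) :
    ncRank (dmSpace K (2 * p + 1) p : Set (Matrix (ExtIdx (2 * p + 1) (p + 1))
      (ExtIdx (2 * p + 1) p) K)) = (2 * p + 1).choose p :=
  ncRank_dmSpace_full p

/-- `ncrk 𝒳(p, 2p+1) = (2p+1)/(p+1) · rk 𝒳(p, 2p+1)` (the content of [DM16, Thm 1.15], cross-multiplied)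
over EVERY field; the named fact `DerksenMakam2018_thm_1_15` itself binds `[CharZero K]` and is
discharged in `DM16FullNcRankProofs.lean`. [cite: DerksenMakam2018, Thm 1.15, p. 4] locator: paper:arxiv-1606.06701 p0004.txt:L42 -/
theorem ncRank_dmSpace_ratio_allFields (K : Type*) [Field K] (p : ℕ) :
    (p + 1) * ncRank (dmSpace K (2 * p + 1) p : Set (Matrix (ExtIdx (2 * p + 1) (p + 1))
        (ExtIdx (2 * p + 1) p) K)) =
      (2 * p + 1) * matrixSetRank (dmSpace K (2 * p + 1) p : Set (Matrix (ExtIdx (2 * p + 1) (p + 1))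
        (ExtIdx (2 * p + 1) p) K)) := by
  rw [ncRank_dmSpace_full, matrixSetRank_dmSpace (by omega), Nat.add_sub_cancel,
    succ_mul_choose_two_mul_add_one]

end Full

/-! ## 3. [EGOW18, §6 bullet 4] and Conj 6.1 at `d = 1` over every field -/

section EGOW

/-- `hrk` of the relabelled linear matrix `A(p,2p+1)` is `C(2p+1,p)` over EVERY field.
[cite: EfremenkoGargOliveiraWigderson2018, §6, p. 17] locator: paper:arxiv-1710.09502 p0017.txt:L20 -/
theorem homogRank_genericCombination_dmSquareFamily_full {F : Type*} [Field F] (p : ℕ) :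
    homogRank (genericCombination (dmSquareFamily F p)) = (2 * p + 1).choose p := by
  rw [homogRank_genericCombination_eq_ncRank, ncRank_range_dmSquareFamily]
  exact ncRank_dmSpace_full p

/-- **DISCHARGE of the named [EGOW18, §6 bullet 4] statement `EGOW2018_sec6_derksenMakam` over
EVERY field** ("there exists a linear matrix `M(x)` of rank `r` whose homogeneous rank is lower
bounded by `(2 − ε) · r`"): witness `A(p, 2p+1)` with `1/(p+1) < ε`, `rk = C(2p,p)`,
`hrk = C(2p+1,p)`. The source works in characteristic `0`; no field hypothesis is needed.
[cite: EfremenkoGargOliveiraWigderson2018, §6, p. 17] locator: paper:arxiv-1710.09502 p0017.txt:L20 -/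
theorem EGOW2018_sec6_derksenMakam_holds :
    ∀ (F : Type*) [Field F], EGOW2018_sec6_derksenMakam F := by
  intro F _ ε hε
  obtain ⟨p, hp⟩ := exists_nat_gt (1 / ε)
  have hpε : 1 / ((p : ℝ) + 1) < ε := by
    rw [div_lt_iff₀ (by positivity)]
    rw [div_lt_iff₀ hε] at hp
    nlinarith
  refine ⟨2 * p + 1, (2 * p + 1).choose p, (2 * p).choose p, genericCombination (dmSquareFamily F p),
    isHomogeneous_genericCombination _, symbolicRank_genericCombination_dmSquareFamily p,
    Nat.choose_pos (by omega), ?_⟩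
  rw [homogRank_genericCombination_dmSquareFamily_full p]
  exact (two_sub_eps_mul_choose_lt hpε).le

/-- **[EGOW18, Conjecture 6.1] HOLDS AT `d = 1` over EVERY field** (the tree's
`EGOW2018_conj61_degOne_of_exists_ne` excludes `𝔽₂`): for every real `ε > 0` there is a square
matrix `M(x)` of linear forms with `hrk(M) > (1 + 1 − ε) · rk_{F(x)}(M)` — clause for clause the
`d = 1` instance of the Summits leaf `EGOW2018_conj61Over F` (not imported here).
[cite: EfremenkoGargOliveiraWigderson2018, Conj 6.1, p. 17] locator: paper:arxiv-1710.09502 p0017.txt:L27 -/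
theorem EGOW2018_conj61_degOne_allFields (F : Type*) [Field F] (ε : ℝ) (hε : 0 < ε) :
    ∃ (n m r : ℕ) (M : Matrix (Fin m) (Fin m) (MvPolynomial (Fin n) F)),
      (∀ i j, (M i j).IsHomogeneous 1) ∧ symbolicRank M = r ∧
        (((1 : ℕ) : ℝ) + 1 - ε) * r < (homogRank M : ℝ) := by
  obtain ⟨p, hp⟩ := exists_nat_gt (1 / ε)
  have hpε : 1 / ((p : ℝ) + 1) < ε := by
    rw [div_lt_iff₀ (by positivity)]
    rw [div_lt_iff₀ hε] at hp
    nlinarith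
  refine ⟨2 * p + 1, (2 * p + 1).choose p, (2 * p).choose p, genericCombination (dmSquareFamily F p),
    isHomogeneous_genericCombination _, symbolicRank_genericCombination_dmSquareFamily p, ?_⟩
  rw [homogRank_genericCombination_dmSquareFamily_full p]
  have h : ((1 : ℕ) : ℝ) + 1 - ε = 2 - ε := by norm_num
  rw [h]
  exact two_sub_eps_mul_choose_lt hpε

end EGOW

end Literature.Computability.AlgebraicComplexity
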